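import Summits.AtomisticToContinuum.Crystallization.Theorems.PhononSlackCertificatesPeriodicGivenLayeredClosing1
import Mathlib.Analysis.PSeries

/-!
# `PeriodicGivenLayered` (stmt-AtomisticToContinuum-11779), line `Sketch`, stub `stub_closing` — part 2

The **per-layer price of a stacking fault at free heights** (lead prover-line-stmt-AtomisticToContinuum-11779-0).
For a Hägg word `s`, heights `z` with increments in `[39a/50, 17a/20]`, the registry facts of
`stub_registry` (`D_a ≤ 0` and non-decreasing on `[39a/25, ∞)`, corner gap `c₀`) and the decay
`|Φ(H)| ≤ C/H⁴` of `stub_layerCake`, the layer energy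
`ε_m(s) = Φ₀ + Σ'_{m' ≠ m} Φ(z m' − z m, L_s m' − L_s m)` exceeds that of the alternating word AT THE
SAME HEIGHTS by at least `c₀` whenever `s (m+1) = s m` (a fault at `m`), and is never smaller
(`clo_layer_price`). Proof: split the `ℤ`-sum into the layers above (`= haggLocalEnergy` of the
height-dependent couplings `J k = D(z (m+k) − z m)`, priced by `clo_forward_price`) and below
(`= haggBackwardLocalEnergy` of `J' k = D(z m − z (m−k))`, non-negative difference by `clo_backward_le`).
-/

noncomputable section

namespace Summit.AtomisticToContinuum.Crystallization.Theorems.LayeredHull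

open scoped BigOperators
open Finset Filter Literature.MathematicalPhysics.StatisticalMechanics

/-! ## Heights of layers at distance `k` -/

/-- Heights above: `39ak/50 ≤ z (m+k) − z m ≤ 17ak/20`. [folklore] -/
theorem clo_height_add {a : ℝ} {z : ℤ → ℝ}
    (hz : ∀ m : ℤ, 39 / 50 * a ≤ z (m + 1) - z m ∧ z (m + 1) - z m ≤ 17 / 20 * a) (m : ℤ) (k : ℕ) :
    39 / 50 * a * k ≤ z (m + k) - z m ∧ z (m + k) - z m ≤ 17 / 20 * a * k := by
  induction k with
  | zero => simp
  | succ k ih =>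
    have h := hz (m + k)
    push_cast
    rw [← add_assoc]
    constructor <;> nlinarith [ih.1, ih.2, h.1, h.2]

/-- Heights below: `39ak/50 ≤ z m − z (m−k) ≤ 17ak/20`. [folklore] -/
theorem clo_height_sub {a : ℝ} {z : ℤ → ℝ}
    (hz : ∀ m : ℤ, 39 / 50 * a ≤ z (m + 1) - z m ∧ z (m + 1) - z m ≤ 17 / 20 * a) (m : ℤ) (k : ℕ) :
    39 / 50 * a * k ≤ z m - z (m - k) ∧ z m - z (m - k) ≤ 17 / 20 * a * k := by
  have := clo_height_add hz (m - k) k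
  rwa [sub_add_cancel] at this

/-! ## Couplings along an admissible height profile -/

/-- **Coupling facts.** If `H : ℕ → ℝ` is non-decreasing with `39ak/50 ≤ H k ≤ 17ak/20` (`a ≥ 47/50`),
the registry coupling is `≤ 0` and non-decreasing on `[39a/25,∞)` with corner gap `c₀`, and the layer
sums decay like `C/H⁴` beyond `|H| ≥ 7/10`, then the couplings `J k = D_a(H k)` are summable,
`≤ 0` and non-decreasing from `k = 2` on, and `c₀ ≤ J 3 − J 2`. [folklore] -/
theorem clo_coupling_facts {a : ℝ} (ha : 47 / 50 ≤ a) {C c₀ : ℝ}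
    (hdecay : ∀ (H : ℝ) (δ : ℤ), 7 / 10 ≤ |H| → |layerInteraction lennardJones a H δ 1| ≤ C / H ^ 4)
    (hreg1 : ∀ H H' : ℝ, 39 / 25 * a ≤ H → H ≤ H' →
      barlowCoupling lennardJones a H' 1 ≤ 0 ∧
        barlowCoupling lennardJones a H 1 ≤ barlowCoupling lennardJones a H' 1)
    (hreg2 : c₀ ≤ barlowCoupling lennardJones a (117 / 50 * a) 1 - barlowCoupling lennardJones a (17 / 10 * a) 1)
    (H : ℕ → ℝ) (hH : ∀ k : ℕ, 39 / 50 * a * k ≤ H k ∧ H k ≤ 17 / 20 * a * k)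
    (hHmono : ∀ k : ℕ, H k ≤ H (k + 1)) :
    Summable (fun k => barlowCoupling lennardJones a (H k) 1) ∧
    (∀ k, 2 ≤ k → barlowCoupling lennardJones a (H k) 1 ≤ 0) ∧
    (∀ k, 2 ≤ k → barlowCoupling lennardJones a (H k) 1 ≤ barlowCoupling lennardJones a (H (k + 1)) 1) ∧
    c₀ ≤ barlowCoupling lennardJones a (H 3) 1 - barlowCoupling lennardJones a (H 2) 1 := by
  have h156 : ∀ k, 2 ≤ k → 39 / 25 * a ≤ H k := fun k hk => by
    have hk' : (2 : ℝ) ≤ k := by exact_mod_cast hk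
    nlinarith [(hH k).1]
  refine ⟨?_, fun k hk => (hreg1 _ _ (h156 k hk) le_rfl).1,
    fun k hk => (hreg1 _ _ (h156 k hk) (hHmono k)).2, ?_⟩
  · -- summability from the decay `|D(H k)| ≤ 2C/(H k)⁴ ≤ 2C/((7/10)(k+1))⁴·…` for `k ≥ 1`
    have hHk : ∀ k : ℕ, 7 / 10 * ((k : ℝ) + 1) ≤ H (k + 1) := fun k => by
      have := (hH (k + 1)).1
      push_cast at this
      nlinarith
    rw [← summable_nat_add_iff 1]
    have hC : 0 ≤ C := by
      have h1 := hdecay 1 0 (by norm_num)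
      have : (0 : ℝ) ≤ C / 1 ^ 4 := (abs_nonneg _).trans h1
      simpa using this
    refine Summable.of_norm_bounded (g := fun k : ℕ => 2 * C * (10 / 7) ^ 4 * (1 / ((k : ℝ) + 1) ^ 4))
      ?_ fun k => ?_
    · have hs : Summable fun k : ℕ => 1 / ((k : ℝ) + 1) ^ 4 := by
        have := (summable_nat_add_iff 1).2 (Real.summable_one_div_nat_pow.2 (by norm_num : 1 < 4))
        simpa using this
      exact hs.mul_left _
    · have hk0 : (0 : ℝ) < (k : ℝ) + 1 := by positivity
      have hHpos : 7 / 10 * ((k : ℝ) + 1) ≤ H (k + 1) := hHk k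
      have hH7 : 7 / 10 ≤ |H (k + 1)| := by
        rw [abs_of_pos (by nlinarith)]; nlinarith
      have hA := hdecay (H (k + 1)) 0 hH7
      have hN := hdecay (H (k + 1)) 1 hH7
      rw [Real.norm_eq_abs]
      unfold barlowCoupling
      have hH0 : 0 < H (k + 1) := by nlinarith
      have h4 : C / H (k + 1) ^ 4 ≤ C * (10 / 7) ^ 4 * (1 / ((k : ℝ) + 1) ^ 4) := by
        rw [div_le_iff₀ (by positivity)]
        have e1 : ((7 : ℝ) / 10 * ((k : ℝ) + 1)) ^ 4 ≤ H (k + 1) ^ 4 :=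
          pow_le_pow_left₀ (by positivity) hHpos 4
        have e2 : C * (10 / 7) ^ 4 * (1 / ((k : ℝ) + 1) ^ 4) * ((7 : ℝ) / 10 * ((k : ℝ) + 1)) ^ 4 = C := by
          field_simp
        calc C = C * (10 / 7) ^ 4 * (1 / ((k : ℝ) + 1) ^ 4) * ((7 : ℝ) / 10 * ((k : ℝ) + 1)) ^ 4 := e2.symm
          _ ≤ C * (10 / 7) ^ 4 * (1 / ((k : ℝ) + 1) ^ 4) * H (k + 1) ^ 4 := by
              apply mul_le_mul_of_nonneg_left e1; positivity
      calc |layerInteraction lennardJones a (H (k + 1)) 0 ((1 : ℕ) : ℤ) -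
            layerInteraction lennardJones a (H (k + 1)) 1 ((1 : ℕ) : ℤ)|
          ≤ |layerInteraction lennardJones a (H (k + 1)) 0 ((1 : ℕ) : ℤ)| +
            |layerInteraction lennardJones a (H (k + 1)) 1 ((1 : ℕ) : ℤ)| := abs_sub _ _
        _ ≤ C / H (k + 1) ^ 4 + C / H (k + 1) ^ 4 := add_le_add hA hN
        _ ≤ 2 * C * (10 / 7) ^ 4 * (1 / ((k : ℝ) + 1) ^ 4) := by linarith
  · -- corner gap: `D(117a/50) ≤ D(H 3)` and `D(H 2) ≤ D(17a/10)`
    have h3 : 117 / 50 * a ≤ H 3 := by have := (hH 3).1; norm_num at this ⊢; linarith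
    have h2u : H 2 ≤ 17 / 10 * a := by have := (hH 2).2; norm_num at this ⊢; linarith
    have hA := (hreg1 (117 / 50 * a) (H 3) (by nlinarith) h3).2
    have hB := (hreg1 (H 2) (17 / 10 * a) (h156 2 le_rfl) h2u).2
    linarith

/-! ## Splitting a `ℤ`-sum at a layer -/

/-- `∑'_{m' ∈ ℤ} f m' = ∑'_{n ∈ ℕ} f (m + n) + ∑'_{n ∈ ℕ} f (m − (n+1))` for summable `f`. [folklore] -/
theorem clo_tsum_int_split (f : ℤ → ℝ) (m : ℤ) (hf : Summable f) :
    ∑' m' : ℤ, f m' = (∑' n : ℕ, f (m + n)) + ∑' n : ℕ, f (m - (n + 1 : ℕ)) := by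
  have hf' : Summable fun k : ℤ => f (m + k) := (Equiv.addLeft m).summable_iff.2 hf
  have hs1 : Summable fun n : ℕ => f (m + n) := hf'.comp_injective Nat.cast_injective
  have hs2 : Summable fun n : ℕ => f (m + (-((n : ℤ) + 1))) :=
    hf'.comp_injective (i := fun n : ℕ => -((n : ℤ) + 1)) fun a b h => by
      simp only [neg_add_rev, neg_inj, add_right_inj, Nat.cast_inj] at h
      exact h
  rw [← (Equiv.addLeft m).tsum_eq f]
  simp only [Equiv.coe_addLeft]
  rw [tsum_of_nat_of_neg_add_one (f := fun k : ℤ => f (m + k)) hs1 hs2]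
  rfl

/-! ## The per-layer price -/

/-- The layers above: the difference of the registry terms of `s` and of the alternating word at
`m + n` is the difference of the masked couplings `J n = D(z (m+n) − z m)`. [folklore] -/
theorem clo_diff_above {a : ℝ} {s : ℤ → ℤ} (hs : IsHaggSeq s) (z : ℤ → ℝ) (m : ℤ) (n : ℕ) :
    ((if m + (n : ℤ) = m then (0 : ℝ) else
        layerInteraction lennardJones a (z (m + n) - z m) (haggLabel s (m + n) - haggLabel s m) 1) -
      (if m + (n : ℤ) = m then (0 : ℝ) else
        layerInteraction lennardJones a (z (m + n) - z m)
          (haggLabel alternatingHagg (m + n) - haggLabel alternatingHagg m) 1)) =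
    (if 2 ≤ n ∧ HaggAligned s m n then barlowCoupling lennardJones a (z (m + n) - z m) 1 else 0) -
      (if 2 ≤ n ∧ HaggAligned alternatingHagg m n then
        barlowCoupling lennardJones a (z (m + n) - z m) 1 else 0) := by
  rcases Nat.lt_or_ge n 2 with hn | hn
  · interval_cases n
    · simp
    · have h1 : m + ((1 : ℕ) : ℤ) ≠ m := by simp
      rw [if_neg h1, if_neg h1, clo_layerInteraction_label_add, clo_layerInteraction_label_add,
        if_neg (not_haggAligned_one hs m), if_neg (not_haggAligned_one isHaggSeq_alternating m)]
      simp
  · have h1 : m + (n : ℤ) ≠ m := by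
      have : (n : ℤ) ≠ 0 := by exact_mod_cast (show n ≠ 0 by omega)
      intro h; apply this; linarith
    rw [if_neg h1, if_neg h1, clo_layerInteraction_label_add, clo_layerInteraction_label_add]
    simp only [hn, true_and]
    ring

/-- The layers below: the difference at `m − (n+1)` is the difference of the masked couplings
`J' (n+1) = D(z m − z (m−(n+1)))` (evenness of the layer sums in the height). [folklore] -/
theorem clo_diff_below {a : ℝ} (s : ℤ → ℤ) (z : ℤ → ℝ) (m : ℤ) (n : ℕ) :
    ((if m - ((n + 1 : ℕ) : ℤ) = m then (0 : ℝ) else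
        layerInteraction lennardJones a (z (m - (n + 1 : ℕ)) - z m)
          (haggLabel s (m - (n + 1 : ℕ)) - haggLabel s m) 1) -
      (if m - ((n + 1 : ℕ) : ℤ) = m then (0 : ℝ) else
        layerInteraction lennardJones a (z (m - (n + 1 : ℕ)) - z m)
          (haggLabel alternatingHagg (m - (n + 1 : ℕ)) - haggLabel alternatingHagg m) 1)) =
    (if HaggAligned s (m - (n + 1 : ℕ)) (n + 1) then
        barlowCoupling lennardJones a (z m - z (m - (n + 1 : ℕ))) 1 else 0) -
      (if HaggAligned alternatingHagg (m - (n + 1 : ℕ)) (n + 1) then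
        barlowCoupling lennardJones a (z m - z (m - (n + 1 : ℕ))) 1 else 0) := by
  have h1 : m - ((n + 1 : ℕ) : ℤ) ≠ m := by
    have : ((n + 1 : ℕ) : ℤ) ≠ 0 := by positivity
    intro h; apply this; linarith
  rw [if_neg h1, if_neg h1, clo_layerInteraction_label_sub, clo_layerInteraction_label_sub]
  have heven : barlowCoupling lennardJones a (z (m - ((n + 1 : ℕ) : ℤ)) - z m) 1 =
      barlowCoupling lennardJones a (z m - z (m - ((n + 1 : ℕ) : ℤ))) 1 := by
    rw [show z (m - ((n + 1 : ℕ) : ℤ)) - z m = -(z m - z (m - ((n + 1 : ℕ) : ℤ))) by ring]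
    unfold barlowCoupling
    simp only [Nat.cast_one]
    rw [clo_layerInteraction_neg_height, clo_layerInteraction_neg_height]
  rw [heven]
  ring

/-- **Per-layer price of a fault at free heights.** For a Hägg word `s`, admissible heights `z`, the
registry facts and the decay of the layer sums, the registry energy of layer `m` of the word `s`
exceeds that of the alternating word at the same heights by at least `c₀·1[s (m+1) = s m]`:
`c₀ · 1[fault at m] ≤ Σ'_{m'≠m} Φ(z m' − z m, L_s m' − L_s m) − Σ'_{m'≠m} Φ(z m' − z m, L_alt m' − L_alt m)`.
[folklore] -/
theorem clo_layer_price {a : ℝ} (ha : 47 / 50 ≤ a) {s : ℤ → ℤ} (hs : IsHaggSeq s) {z : ℤ → ℝ}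
    (hz : ∀ m : ℤ, 39 / 50 * a ≤ z (m + 1) - z m ∧ z (m + 1) - z m ≤ 17 / 20 * a) {C c₀ : ℝ}
    (hdecay : ∀ (H : ℝ) (δ : ℤ), 7 / 10 ≤ |H| → |layerInteraction lennardJones a H δ 1| ≤ C / H ^ 4)
    (hreg1 : ∀ H H' : ℝ, 39 / 25 * a ≤ H → H ≤ H' →
      barlowCoupling lennardJones a H' 1 ≤ 0 ∧
        barlowCoupling lennardJones a H 1 ≤ barlowCoupling lennardJones a H' 1)
    (hreg2 : c₀ ≤ barlowCoupling lennardJones a (117 / 50 * a) 1 - barlowCoupling lennardJones a (17 / 10 * a) 1)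
    (m : ℤ)
    (hsum_s : Summable fun m' : ℤ => if m' = m then (0 : ℝ) else
      layerInteraction lennardJones a (z m' - z m) (haggLabel s m' - haggLabel s m) 1)
    (hsum_a : Summable fun m' : ℤ => if m' = m then (0 : ℝ) else
      layerInteraction lennardJones a (z m' - z m) (haggLabel alternatingHagg m' - haggLabel alternatingHagg m) 1) :
    c₀ * (if s (m + 1) = -s m then (0 : ℝ) else 1) ≤
      (∑' m' : ℤ, if m' = m then (0 : ℝ) else
        layerInteraction lennardJones a (z m' - z m) (haggLabel s m' - haggLabel s m) 1) -
      (∑' m' : ℤ, if m' = m then (0 : ℝ) else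
        layerInteraction lennardJones a (z m' - z m)
          (haggLabel alternatingHagg m' - haggLabel alternatingHagg m) 1) := by
  -- coupling facts above (`J`) and below (`J'`)
  obtain ⟨hJs, hJ0, hJmono, hJc⟩ := clo_coupling_facts ha hdecay hreg1 hreg2
    (fun k : ℕ => z (m + k) - z m) (clo_height_add hz m) (fun k => by
      have := (hz (m + k)).1
      have ha0 : 0 ≤ a := by linarith
      push_cast; rw [← add_assoc]; nlinarith)
  obtain ⟨hJ's, hJ'0, hJ'mono, -⟩ := clo_coupling_facts ha hdecay hreg1 hreg2
    (fun k : ℕ => z m - z (m - k)) (clo_height_sub hz m) (fun k => by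
      have := (hz (m - (k + 1 : ℕ))).1
      have ha0 : 0 ≤ a := by linarith
      push_cast at this ⊢
      rw [show m - ((k : ℤ) + 1) + 1 = m - k by ring] at this
      nlinarith)
  -- one `ℤ`-sum, split at `m`
  rw [← hsum_s.tsum_sub hsum_a, clo_tsum_int_split _ m (hsum_s.sub hsum_a)]
  -- the layers above: `haggLocalEnergy J s m − haggLocalEnergy J alt m ≥ c₀·1[fault]`
  have hup : ∑' n : ℕ, ((if m + (n : ℤ) = m then (0 : ℝ) else
        layerInteraction lennardJones a (z (m + n) - z m) (haggLabel s (m + n) - haggLabel s m) 1) -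
      (if m + (n : ℤ) = m then (0 : ℝ) else
        layerInteraction lennardJones a (z (m + n) - z m)
          (haggLabel alternatingHagg (m + n) - haggLabel alternatingHagg m) 1)) =
      haggLocalEnergy (fun k : ℕ => barlowCoupling lennardJones a (z (m + k) - z m) 1) s m -
        haggLocalEnergy (fun k : ℕ => barlowCoupling lennardJones a (z (m + k) - z m) 1)
          alternatingHagg m := by
    unfold haggLocalEnergy
    rw [← (summable_ite_of_summable hJs _).tsum_sub (summable_ite_of_summable hJs _)]
    exact tsum_congr fun n => clo_diff_above hs z m n
  -- the layers below: `haggBackwardLocalEnergy J' s m − haggBackwardLocalEnergy J' alt m ≥ 0`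
  have hdown : ∑' n : ℕ, ((if m - ((n + 1 : ℕ) : ℤ) = m then (0 : ℝ) else
        layerInteraction lennardJones a (z (m - (n + 1 : ℕ)) - z m)
          (haggLabel s (m - (n + 1 : ℕ)) - haggLabel s m) 1) -
      (if m - ((n + 1 : ℕ) : ℤ) = m then (0 : ℝ) else
        layerInteraction lennardJones a (z (m - (n + 1 : ℕ)) - z m)
          (haggLabel alternatingHagg (m - (n + 1 : ℕ)) - haggLabel alternatingHagg m) 1)) =
      haggBackwardLocalEnergy (fun k : ℕ => barlowCoupling lennardJones a (z m - z (m - k)) 1) s m -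
        haggBackwardLocalEnergy (fun k : ℕ => barlowCoupling lennardJones a (z m - z (m - k)) 1)
          alternatingHagg m := by
    have hS1 : Summable fun n : ℕ => (if HaggAligned s (m - (n + 1 : ℕ)) (n + 1) then
        barlowCoupling lennardJones a (z m - z (m - (n + 1 : ℕ))) 1 else 0) :=
      (summable_nat_add_iff (f := fun k : ℕ =>
        if HaggAligned s (m - k) k then barlowCoupling lennardJones a (z m - z (m - k)) 1 else 0) 1).2
        (summable_ite_of_summable hJ's _)
    have hS2 : Summable fun n : ℕ => (if HaggAligned alternatingHagg (m - (n + 1 : ℕ)) (n + 1) then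
        barlowCoupling lennardJones a (z m - z (m - (n + 1 : ℕ))) 1 else 0) :=
      (summable_nat_add_iff (f := fun k : ℕ =>
        if HaggAligned alternatingHagg (m - k) k then
          barlowCoupling lennardJones a (z m - z (m - k)) 1 else 0) 1).2
        (summable_ite_of_summable hJ's _)
    rw [tsum_congr (fun n => clo_diff_below (a := a) s z m n), hS1.tsum_sub hS2,
      tsum_ite_succ_eq (P := fun k => HaggAligned s (m - k) k) (not_haggAligned_one hs _)
        (fun k : ℕ => barlowCoupling lennardJones a (z m - z (m - k)) 1),
      tsum_ite_succ_eq (P := fun k => HaggAligned alternatingHagg (m - k) k)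
        (not_haggAligned_one isHaggSeq_alternating _)
        (fun k : ℕ => barlowCoupling lennardJones a (z m - z (m - k)) 1)]
    simp only [haggBackwardLocalEnergy]
  rw [hup, hdown]
  have hf := clo_forward_price hs hJs hJ0 hJmono hJc m
  have hb := clo_backward_le hs hJ's hJ'0 hJ'mono m
  linarith

end Summit.AtomisticToContinuum.Crystallization.Theorems.LayeredHull

end
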